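import Summits.HodgeConjecture.HodgeConjecture.Theorems.F0P6aStubE6Sockets                       -- ★ re-homed σ1 socket words `Reads` ∕ `RingActionReading` over the E-defs (D) `AuxChartGS`
import Summits.HodgeConjecture.HodgeConjecture.Theorems.F0P6aChartFramePin                        -- ★ re-homed frame pin `IsChartOfFrame`
import Literature.AlgebraicGeometry.ShimuraVarieties.UnitaryCurveAuxiliaryTorusLegLattice          -- ★ p850466…p850531 (LA5-p02): (K) ∕ `hint` at a moved representative
import Literature.AlgebraicGeometry.ShimuraVarieties.UnitaryCurveAuxiliaryHeckeTransporter         -- ★ `exists_mem_principalLevelSubgroup_eq_of_smul_mk_eq` (the mover՚s representative)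
import Literature.AlgebraicGeometry.ModuliOfAbelianVarieties.SiegelAdelicMarkingPrincipalTransport  -- ★ `SiegelAdelicMarking.exists_of_isLatticeBasis` (re-index a marking, same lattice)
import Literature.AlgebraicGeometry.ModuliOfAbelianVarieties.SiegelCMSpecialPairMover              -- ★ `SiegelShimuraSet.mk_inv_mul_eq_of_conjJ_eq` (classes at the moved complex structure)
import HarnessLib

/-!
# σ1-UNPACK: the twisted-marking INPUTS at a complex point of the chart sheet (the `A, act, m, M, hread, hint, hr` of the Serre-tensor marking organ)
# ([Milne 2005] Thm. 6.11 + (63); [Shimura 1998] §18.3, §18.6: `A ⊗ 𝔞⁻¹ = ℂ^g ∕ 𝔞⁻¹Λ`; RSZ §3.2: the sheets)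

Cell `hodgecm-mathlib` (D-0151), FLOOR 0, P6 «MOD programme», crux hLiu418 (stmt-HodgeConjecture-24832, `--supports`, count-neutral), line «L4», closer
`Lines/F0_P6a_StubESHEET.lean`, socket `hole_SHEET_complex : OrganSHEETComplex` (LA7-p01 (g3) LEG-E frame v6b), ROAD B′.  **ORGAN «σ1-UNPACK»** (LA7-p01 (g3)
08:37:05Z «the handless input»; = OFFER (b) of LA4-p05 (g4) 08:24:16Z, LA4-p03 (g3) hand): from the σ1 reading `RingActionReading C ε ρ` (★ `Reads`, ∃-representative
form) AT ONE complex point `x` of `X = (S.M Kc) ⊗_F Fᵢ` over `τE`, together with the frame pin and a torus idèle `z` with `[z] = 𝔞⁻¹`, PRODUCE the inputs of ★ p850517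
`SiegelAdelicMarking.exists_serreTensor_cover_marked_of_reading` (LA4-p05 (g4), #32′ §2) IN ITS CURRENCY, at the MOVED representative
`r′ := (q a)_𝔸⁻¹ · b(a) = rep(piece a) · k` (`k ∈ K_δ(N)`, ★ `exists_mem_principalLevelSubgroup_eq_of_smul_mk_eq` on the chart՚s mover law `q_spec`):
* a representative `(v, a)` of the flat point, the marking `m : SiegelAdelicMarking ⟨J(C.Z a v), _⟩ r′ (P.A_x)` (σ1՚s unit-frame marking RE-INDEXED from `rep(piece a)` to
  `r′` — same lattice, ★ `exists_of_isLatticeBasis`), with σ1՚s polarisation ∕ level readings (`Θ`, `Λ`, `IsLambdaOfAt`, `Λ.lift = m.r` on `AdelicCongr (rep⁻¹)`) and `γ = 1`,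
  `Ψ = Π_{Z a v}` carried along (`m.r` unchanged);
* **`hread`**: `(ρ_x b)(m.r w) = m.r ((Mρ a b)_ℚ · w)` — σ1՚s TORUS reading made RATIONAL by ★ `SiegelAdelicMarking.map_r_eq_of_map_toFun_mapMatrix` (unit frame);
* **`hint`**, **`hr`**: `(Mρ a b)_ℚ` preserves `Λ_{r′}` and `Λ_{r′·ũ_V(1,z)} = 𝔞⁻¹·Λ_{r′}` — LA5-p02՚s ★ (K)∕`hint` at a moved representative (`mem_latticeOfGL_mul_torusLeg_iff_of_coe_eq_map_mul`,
  `conj_reading_mulVec_mem_latticeOfGL_of_coe_eq_map_mul`) with `γ := (q a)⁻¹`, `p := (a, 1)`, the frame law `AuxChartGS.Mρ_frame` (`(Mρ a b)_ℚ = (q a)⁻¹ ρ₀(b)_ℚ (q a)`) and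
  the pin (`C.b = ũ_V(·, 1)`, `ρ₀ = ` the frame reading);
* **the class identity** `[J(C.Z a v), r′ · ũ_V(1,z)] = [C.J v, C.b a · ũ_V(1,z)]` in `Sh_{K_δ(N)}(GSp_δ)(ℂ)` (★ `SiegelShimuraSet.mk_inv_mul_eq_of_conjJ_eq` on `q_spec`.1) — the
  twisted marked fibre՚s class IS the twisted chart shadow of DEAL #37 (`C.pts (f₂ [v, a]) = [C.J v, C.b a · ũ_V(1,z)]`), so #34 (ADM ⇒ ISO) and #37 (the point law on
  the conjugate sheet, ★ p850504) MEET;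
* `hA : (P.A_x).IsOfRelDim C.g` (`PolarizedAbelianSchemeWithLevel.relDim` under base change).
THEOREMS ONLY (no definition, no instance, no named fact, no `sorry`); ★ twin over the re-homed Theorems defs (a HOME by-import copy over the tree `Lines/` originals
serves the closer).  HONEST LABEL: HC_CM is proved only modulo the 7 printed citations (2 remaining: hLiu418 = stmt-HodgeConjecture-24832, h413 = stmt-HodgeConjecture-24833)
until rung 0 closes; this file is count-neutral.

## References
* [Milne2005ShimuraVarieties] J. S. Milne, *Introduction to Shimura varieties* (2005; rev. 2017), §4 pp. 48–49, §5 p. 57, §6 Thm. 6.11 pp. 74–75, §12 (63) p. 116.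
* [Shimura1998] G. Shimura, *Abelian Varieties with Complex Multiplication and Modular Functions* (1998), §18.3 pp. 122–123, §18.6 pp. 124–127.
* [RapoportSmithlingZhang2020Diagonal] M. Rapoport, B. Smithling, W. Zhang (2020), §3.2 p. 11 (the sheets of `M ⊗_F Fᵢ` and their twists).
* [Kottwitz1992] R. Kottwitz, *Points on some Shimura varieties over finite fields*, JAMS 5 (1992), §5 p. 390.
-/

set_option autoImplicit false

noncomputable section

namespace Summit.HodgeConjecture.HodgeConjecture.Theorems.F0P6aSheetPointTwistedMarkingInputs

set_option linter.dupNamespace false  -- `Summit.HodgeConjecture.HodgeConjecture.…` BY DESIGN (D-0017)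

open CategoryTheory CategoryTheory.Limits NumberField IsDedekindDomain MulAction Matrix AlgebraicGeometry
open scoped Matrix ComplexOrder MonObj nonZeroDivisors
open Literature.AlgebraicGeometry.Motives (SchemeOver AlgPoints ComplexPoints specOver)
open Literature.AlgebraicGeometry.Motives.AbelianVariety (bcSpec)
open Literature.AlgebraicGeometry.AbelianSchemes (PolarizedAbelianSchemeWithLevel AbelianSchemeOver)
open Literature.AlgebraicGeometry.ModuliOfAbelianVarieties
open Literature.AlgebraicGeometry.ShimuraVarieties Literature.AlgebraicGeometry.ShimuraVarieties.UnitaryCanonicalModel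
open Literature.AlgebraicGeometry.ShimuraVarieties.UnitaryCurve Literature.AlgebraicGeometry.ShimuraVarieties.UnitaryCurve.AuxV
open Literature.NumberTheory.Automorphic Literature.NumberTheory.Automorphic.UnitaryGroup
open Literature.NumberTheory.Automorphic.Liu2021.AppendixC (C5.OpenCompactSubgroup C5.SmallLevel)
open Literature.Geometry.Kaehler (ComplexTorus)
open Literature.NumberTheory.Adeles (latticeOfGL)
open Literature.AlgebraicGeometry.ShimuraVarieties.UnitaryCanonicalModel.Aux (torusFinAdelic)
open Summit.HodgeConjecture.HodgeConjecture.Cruxes.HLiu418.F0P6aPELWitnessE (GSAdele IsCMTypeThrough mOf AuxChartGS)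
open Summit.HodgeConjecture.HodgeConjecture.Cruxes.HLiu418.F0P6aStubE6 (Reads RingActionReading)
open Summit.HodgeConjecture.HodgeConjecture.Cruxes.HLiu418.F0P6aChartFramePin (IsChartOfFrame)
open Literature.NumberTheory.ComplexMultiplication.CMTypeOps (flip bar)

variable {F : Type} [Field F] [NumberField F] [IsCMField F] {ι₁ : F →+* ℂ} {Jstar : Matrix (Fin 2) (Fin 2) F}
  {K₀ : C5.OpenCompactSubgroup (GSAdele F Jstar)} {S : RecordSystemGS F Jstar ι₁ K₀} {Kc : C5.SmallLevel K₀}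
  {Fi : Type} [Field Fi] [NumberField Fi] [Algebra F Fi] {τE : Fi →+* ℂ} {Φ : Set (F →+* ℂ)}

/-! ### §1 Two chart-currency lemmas: the moved reading and the moved class -/

/-- **The lattice reading at `a` is the frame reading conjugated by the mover**: `(Mρ a b)_ℚ = γ · ρ₀(b)_ℚ · γ⁻¹` with `γ := (q a)⁻¹ ∈ GSp_δ(ℚ)` (the field
`AuxChartGS.Mρ_frame`, re-bracketed for LA5-p02՚s moved (K)). [cite: Milne2005ShimuraVarieties, §6 Thm. 6.11 p. 74 and p. 75] [cite: Kottwitz1992, §5 p. 390] -/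
theorem map_Mρ_eq_conj (C : AuxChartGS F ι₁ Jstar K₀ S Kc Fi τE Φ) {v : Fin 2 → ℂ} (hv : v ∈ negCone (Jstar.map ι₁)) (a : GSAdele F Jstar) (b : 𝓞 F) :
    (C.Mρ a b).map (Int.cast : ℤ → ℚ) =
      ((((C.q a)⁻¹ : ↥(gspRational C.δ)) : GL (Fin C.g ⊕ Fin C.g) ℚ) : Matrix (Fin C.g ⊕ Fin C.g) (Fin C.g ⊕ Fin C.g) ℚ) *
        (C.ρ₀ b).map (Int.cast : ℤ → ℚ) *
        ((((((C.q a)⁻¹ : ↥(gspRational C.δ)) : GL (Fin C.g ⊕ Fin C.g) ℚ))⁻¹ : GL (Fin C.g ⊕ Fin C.g) ℚ) :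
          Matrix (Fin C.g ⊕ Fin C.g) (Fin C.g ⊕ Fin C.g) ℚ) := by
  rw [C.Mρ_frame v hv a b, Subgroup.coe_inv, inv_inv]

/-- **The twisted marked class at the moved complex structure is the twisted chart class**: `[J(C.Z a v), (q a)_𝔸⁻¹ · (C.b a · u)] = [C.J v, C.b a · u]` for ANY
`u ∈ GSp_δ(𝔸_f)` (★ `SiegelShimuraSet.mk_inv_mul_eq_of_conjJ_eq` on the mover law `q_spec`.1: `(q a)_ℝ⁻¹ J(v) (q a)_ℝ = J(C.Z a v)`). With `u := ũ_V(1,z)` the right-hand side is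
the twisted chart shadow of DEAL #37. [cite: Milne2005ShimuraVarieties, §5 p. 57 and Rem. 12.9 p. 115] [cite: RapoportSmithlingZhang2020Diagonal, §3.2 p. 11] -/
theorem mk_jOfSiegel_inv_mul_eq_mk (C : AuxChartGS F ι₁ Jstar K₀ S Kc Fi τE Φ) (K' : Subgroup ↥(gspFinAdelic C.δ))
    {v : Fin 2 → ℂ} (hv : v ∈ negCone (Jstar.map ι₁)) (a : GSAdele F Jstar) (hZv : C.Z a v ∈ siegelUpperHalfSpace C.g) (u : ↥(gspFinAdelic C.δ)) :
    SiegelShimuraSet.mk C.δ K' ⟨SiegelModuli.jOfSiegel C.δ (C.Z a v), C0_subset_C0pm C.δ (SiegelModuli.jOfSiegel_mem_C0 C.hδ.1 hZv)⟩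
        ((gspRationalToFinAdelic C.δ (C.q a))⁻¹ * (C.b a * u)) =
      SiegelShimuraSet.mk C.δ K' ⟨C.J v, C.hJ v hv⟩ (C.b a * u) :=
  SiegelShimuraSet.mk_inv_mul_eq_of_conjJ_eq K' (C.q a) ⟨C.J v, C.hJ v hv⟩ _ (C.q_spec v hv a).1 (C.b a * u)

/-! ### §2 THE HEAD: σ1-UNPACK at a complex point of the chart sheet -/

set_option maxHeartbeats 800000 in -- the statement re-binds σ1's eleven-clause reading + five adelic lattice clauses (as ★ `UnitaryCurveConjugateSliceDescends` §2)
/-- **σ1-UNPACK — THE TWISTED-MARKING INPUTS AT A COMPLEX POINT OF THE CHART SHEET.**  For a chart `C` pinned on the frame `Fr` (`IsChartOfFrame`), the canonical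
pull-back `P := univ ×_{𝓜} X` along the slice `ε`, an `𝒪_F`-action `ρ` on `P.A` that READS (`RingActionReading C ε ρ`), a complex point `x` of `X` over `τE` with flat
shadow `Pflat`, a non-zero ideal `𝔞` and a torus idèle `z` with `[z] = 𝔞⁻¹`: there are a representative `(v, a)` of `pts Pflat`, the mover՚s `k ∈ K_δ(N)` with
`rep(piece a) = (q a)_𝔸⁻¹ · b(a) · k⁻¹`, a unit-frame marking `m` of the fibre `A := P.A ×_X x` by `[J(C.Z a v), r′]` at the MOVED representative `r′ := (q a)_𝔸⁻¹ · b(a)`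
with σ1՚s polarisation and level readings, and: `hA` (relative dimension `g`), **`hread`** (the action `ρ.baseChange x` reads `(Mρ a ·)_ℚ` on the rational torsion
`m.r`), **`hint`** (`(Mρ a b)_ℚ · Λ_{r′} ⊆ Λ_{r′}`), **`hr`** (`Λ_{r′·ũ_V(1,z)} = 𝔞⁻¹ · Λ_{r′}` for the `𝒪_F`-structure `Mρ a`) and the **class identity**
`[J(C.Z a v), r′ · ũ_V(1,z)] = [C.J v, C.b a · ũ_V(1,z)]` — EXACTLY the binders `A act hA m M hread 𝔞 h𝔞 hint hr` of ★ p850517 (`r := r′ · ũ_V(1,z)`), plus the datum that makes its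
output marking meet DEAL #37՚s point.  [cite: Milne2005ShimuraVarieties, §6 Thm. 6.11 pp. 74–75, §12 (63) p. 116, §5 p. 57] [cite: Shimura1998, §18.3 pp. 122–123, §18.6 pp. 124–127]
[cite: RapoportSmithlingZhang2020Diagonal, §3.2 p. 11] [cite: Kottwitz1992, §5 p. 390] -/
theorem exists_twistedMarkingInputs_of_ringActionReading (hΦ : IsCMTypeThrough ι₁ Φ) (C : AuxChartGS F ι₁ Jstar K₀ S Kc Fi τE Φ)
    (ξ : F) (kFr : ℕ) (Fr : SymplecticFrameV F (RingHom.id F) Jstar ((kFr : ℚ) • ξ) C.g C.δ) (hpin : IsChartOfFrame hΦ C ξ kFr Fr)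
    (ε : (Literature.AlgebraicGeometry.Motives.baseChange F Fi).obj (S.M.obj Kc) ⟶
        (Literature.AlgebraicGeometry.Motives.baseChange ℚ Fi).obj C.𝓜.M)
    (ρ : AbelianSchemeOver.RingAction (𝓞 F) (C.𝓜.univ.baseChange (ε.left ≫ pullback.fst C.𝓜.M.hom (bcSpec ℚ Fi))).A)
    (hρ : RingActionReading C ε ρ)
    (x : letI : Algebra Fi ℂ := τE.toAlgebra; ComplexPoints ((Literature.AlgebraicGeometry.Motives.baseChange F Fi).obj (S.M.obj Kc)))
    (Pflat : letI : Algebra F ℂ := ι₁.toAlgebra; ComplexPoints (S.M.obj Kc))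
    (hx : Pflat.left = x.left ≫ pullback.fst (S.M.obj Kc).hom (bcSpec F Fi))
    (𝔞 : Ideal (𝓞 F)) (h𝔞 : 𝔞 ≠ ⊥) (z : ↥(torusFinAdelic F))
    (hz : FiniteAdeleRing.toFractionalIdeal (𝓞 F) F (z : (FiniteAdeleRing (𝓞 F) F)ˣ) = ((𝔞 : FractionalIdeal (𝓞 F)⁰ F))⁻¹) :
    letI P := C.𝓜.univ.baseChange (ε.left ≫ pullback.fst C.𝓜.M.hom (bcSpec ℚ Fi))
    ∃ (v : Fin 2 → ℂ) (hv : v ∈ negCone (Jstar.map ι₁)) (a : GSAdele F Jstar) (k : ↥(gspFinAdelic C.δ))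
      (hZv : C.Z a v ∈ siegelUpperHalfSpace C.g)
      (m : SiegelAdelicMarking ⟨SiegelModuli.jOfSiegel C.δ (C.Z a v), C0_subset_C0pm C.δ (SiegelModuli.jOfSiegel_mem_C0 C.hδ.1 hZv)⟩
        ((gspRationalToFinAdelic C.δ (C.q a))⁻¹ * C.b a) (P.A.fibre x.left).toAbelianVariety)
      (Θ : Literature.AlgebraicGeometry.Motives.CartierDivisor (P.A.fibre x.left).toAbelianVariety.X.left)
      (Λ : P.level.SymplecticLift x.left Θ C.δ),
      -- the representative and the mover՚s `k`
      (letI : Algebra F ℂ := ι₁.toAlgebra; S.pts Kc Pflat) = ShimuraSetGS.mk F Jstar ι₁ Kc.1.1 v hv a ∧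
      k ∈ principalLevelSubgroup C.δ C.N ∧
      C.rep (C.piece a) = (gspRationalToFinAdelic C.δ (C.q a))⁻¹ * C.b a * k⁻¹ ∧
      -- σ1՚s polarisation ∕ level readings and the unit frame, carried to `r′`
      Θ.IsAmple ∧ P.A.IsLambdaOfAt x.left P.D P.pol.lam Θ ∧
      (∀ ⦃M : ℕ⦄, C.N ∣ M → M ≠ 0 → ∀ (y : Fin C.g ⊕ Fin C.g → ZMod M) (w : Fin C.g ⊕ Fin C.g → ℚ),
        AdelicCongr (((C.rep (C.piece a))⁻¹ : ↥(gspFinAdelic C.δ)) : GL (Fin C.g ⊕ Fin C.g) finAdeleQ) 1 w (fun i => ((y i).val : ℚ) / M) →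
          ((Λ.lift M (Multiplicative.ofAdd y)) : (P.A.fibre x.left).toAbelianVariety.Points ℂ) = m.r w) ∧
      m.γ = 1 ∧ (∀ w : Fin C.g ⊕ Fin C.g → ℝ, m.Ψ w = siegelPeriodMap C.δ (C.Z a v) w) ∧
      -- `hA`
      (P.A.baseChange x.left).IsOfRelDim C.g ∧
      -- `hread` (`(fibreHom f s).hom.hom.hom = (Over.pullback s).map f = (ρ.baseChange s).i b`, both `rfl`)
      (∀ (b : 𝓞 F) (w : Fin C.g ⊕ Fin C.g → ℚ),
        haveI := ρ.isMonHom b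
        AlgPoints.map (AbelianSchemeOver.fibreHom (ρ.i b) x.left).hom.hom.hom (m.r w) = m.r (((C.Mρ a b).map (Int.cast : ℤ → ℚ)) *ᵥ w)) ∧
      -- `hint`
      (∀ w : Fin C.g ⊕ Fin C.g → ℚ,
        w ∈ latticeOfGL ((((gspRationalToFinAdelic C.δ (C.q a))⁻¹ * C.b a : ↥(gspFinAdelic C.δ))) : GL (Fin C.g ⊕ Fin C.g) finAdeleQ) →
        ∀ b ∈ 𝔞, ((C.Mρ a b).map (Int.cast : ℤ → ℚ)) *ᵥ w ∈
          latticeOfGL ((((gspRationalToFinAdelic C.δ (C.q a))⁻¹ * C.b a : ↥(gspFinAdelic C.δ))) : GL (Fin C.g ⊕ Fin C.g) finAdeleQ)) ∧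
      -- `hr`
      (∀ w : Fin C.g ⊕ Fin C.g → ℚ,
        w ∈ latticeOfGL ((((gspRationalToFinAdelic C.δ (C.q a))⁻¹ * C.b a * auxToGspFinV Fr (1, z) : ↥(gspFinAdelic C.δ))) :
            GL (Fin C.g ⊕ Fin C.g) finAdeleQ) ↔
          ∀ b ∈ 𝔞, ((C.Mρ a b).map (Int.cast : ℤ → ℚ)) *ᵥ w ∈
            latticeOfGL ((((gspRationalToFinAdelic C.δ (C.q a))⁻¹ * C.b a : ↥(gspFinAdelic C.δ))) : GL (Fin C.g ⊕ Fin C.g) finAdeleQ)) ∧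
      -- the class identity
      SiegelShimuraSet.mk C.δ (principalLevelSubgroup C.δ C.N)
          ⟨SiegelModuli.jOfSiegel C.δ (C.Z a v), C0_subset_C0pm C.δ (SiegelModuli.jOfSiegel_mem_C0 C.hδ.1 hZv)⟩
          ((gspRationalToFinAdelic C.δ (C.q a))⁻¹ * C.b a * auxToGspFinV Fr (1, z)) =
        SiegelShimuraSet.mk C.δ (principalLevelSubgroup C.δ C.N) ⟨C.J v, C.hJ v hv⟩ (C.b a * auxToGspFinV Fr (1, z)) := by
  letI iFi : Algebra Fi ℂ := τE.toAlgebra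
  letI iF : Algebra F ℂ := ι₁.toAlgebra
  -- σ1 at `x`: the representative `(v, a)` and the reading at the principal representative `(u, rep) := (C.u c, C.rep c)`, `c := piece a`
  -- (tactic hygiene: every `obtain` below destructures a NAMED hypothesis one binder at a time — `rcases` on an application term against this goal is
  --  20× dearer in heartbeats)
  have hρx := hρ x Pflat hx
  obtain ⟨v, hv, a, hpts, hread⟩ := hρx
  have hspec := C.rep_spec (C.piece a)
  obtain ⟨hu1, hu2, hrep1, hmult, hblock⟩ := hspec
  have hreadx := hread (C.u (C.piece a)) (C.rep (C.piece a)) hu1 hu2 hrep1 hmult hblock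
  obtain ⟨m, hm⟩ := hreadx
  obtain ⟨Θ, hΘ⟩ := hm
  obtain ⟨Λ, hh⟩ := hΘ
  obtain ⟨hample, hlam, hlvl, hγ, hΨ, htorus⟩ := hh
  have hZv : C.Z a v ∈ siegelUpperHalfSpace C.g := C.Z_mem a v hv
  -- the mover՚s representative: `rep = (q a)⁻¹ · b a · k⁻¹`, `k ∈ K_δ(N)`
  have hmover := exists_mem_principalLevelSubgroup_eq_of_smul_mk_eq C.N (C.rep (C.piece a)) (C.b a) (C.q a) (C.q_spec v hv a).2
  obtain ⟨k, hk, hrepk⟩ := hmover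
  have hk1 : k ∈ principalLevelSubgroup C.δ 1 := principalLevelSubgroup_anti C.δ (one_dvd C.N) hk
  have hrk : C.rep (C.piece a) * k = (gspRationalToFinAdelic C.δ (C.q a))⁻¹ * C.b a := by
    rw [hrepk, inv_mul_cancel_right]
  -- re-index σ1՚s marking from `rep` to `r′ = rep · k` (same lattice)
  have hbasis : IsLatticeBasis ((gspRationalToFinAdelic C.δ (C.q a))⁻¹ * C.b a) m.γ := by
    rw [← hrk]; exact m.γ_isLatticeBasis.mul_of_mem_principalLevelSubgroup_one hk1
  have hrebase := m.exists_of_isLatticeBasis hbasis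
  obtain ⟨m', hm'⟩ := hrebase
  obtain ⟨hγ', hΨ', -, hr'⟩ := hm'
  -- `hread` on the rational torsion (unit frame), first for `m`, then for `m′`
  have hreadQ : ∀ (b : 𝓞 F) (w : Fin C.g ⊕ Fin C.g → ℚ),
      haveI := ρ.isMonHom b
      AlgPoints.map (AbelianSchemeOver.fibreHom (ρ.i b) x.left).hom.hom.hom (m'.r w) = m'.r (((C.Mρ a b).map (Int.cast : ℤ → ℚ)) *ᵥ w) := by
    intro b w
    haveI := ρ.isMonHom b
    rw [hr', hr']
    exact SiegelAdelicMarking.map_r_eq_of_map_toFun_mapMatrix m hγ (AbelianSchemeOver.fibreHom (ρ.i b) x.left) (C.Mρ a b) (htorus b) w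
  -- the pin: `C.b = ũ_V(·, 1)` and `ρ₀` is the frame reading; the moved representative in LA5-p02՚s shape
  have hb : C.b a = auxToGspFinV Fr (a, 1) := by
    rw [hpin.2.1, MonoidHom.comp_apply, MonoidHom.inl_apply]
  have hr'eq : ((((gspRationalToFinAdelic C.δ (C.q a))⁻¹ * C.b a : ↥(gspFinAdelic C.δ))) : GL (Fin C.g ⊕ Fin C.g) finAdeleQ) =
      Matrix.GeneralLinearGroup.map (algebraMap ℚ finAdeleQ) (((C.q a)⁻¹ : ↥(gspRational C.δ)) : GL (Fin C.g ⊕ Fin C.g) ℚ) *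
        ((auxToGspFinV Fr (a, 1) : ↥(gspFinAdelic C.δ)) : GL (Fin C.g ⊕ Fin C.g) finAdeleQ) := by
    rw [Subgroup.coe_mul, Subgroup.coe_inv, coe_gspRationalToFinAdelic, ← map_inv, ← Subgroup.coe_inv, hb]
  have hM : ∀ b : 𝓞 F, (C.Mρ a b).map (Int.cast : ℤ → ℚ) =
      ((((C.q a)⁻¹ : ↥(gspRational C.δ)) : GL (Fin C.g ⊕ Fin C.g) ℚ) : Matrix (Fin C.g ⊕ Fin C.g) (Fin C.g ⊕ Fin C.g) ℚ) *
        (C.ρ₀ b).map (Int.cast : ℤ → ℚ) *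
        ((((((C.q a)⁻¹ : ↥(gspRational C.δ)) : GL (Fin C.g ⊕ Fin C.g) ℚ))⁻¹ : GL (Fin C.g ⊕ Fin C.g) ℚ) :
          Matrix (Fin C.g ⊕ Fin C.g) (Fin C.g ⊕ Fin C.g) ℚ) := fun b => map_Mρ_eq_conj C hv a b
  refine ⟨v, hv, a, k, hZv, m', Θ, Λ, hpts, hk, hrepk, hample, hlam, fun M hNM hM0 y w hw => ?_, hγ'.trans hγ,
    fun w => by rw [hΨ']; exact hΨ w, ?_, hreadQ, fun w hw b hb𝔞 => ?_, fun w => ?_, ?_⟩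
  · rw [hr']; exact hlvl hNM hM0 y w hw
  · exact (C.𝓜.univ.baseChange (ε.left ≫ pullback.fst C.𝓜.M.hom (bcSpec ℚ Fi))).relDim.baseChange x.left
  · rw [hM b]
    exact conj_reading_mulVec_mem_latticeOfGL_of_coe_eq_map_mul Fr C.ρ₀ hpin.2.2.2 (a, 1) _ _ hr'eq b hw
  · rw [mem_latticeOfGL_mul_torusLeg_iff_of_coe_eq_map_mul Fr C.ρ₀ hpin.2.2.2 (a, 1) z 𝔞 h𝔞 hz _ _ hr'eq w]
    refine forall₂_congr fun b _ => ?_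
    rw [hM b]
  · rw [mul_assoc]
    exact mk_jOfSiegel_inv_mul_eq_mk C _ hv a hZv _

end Summit.HodgeConjecture.HodgeConjecture.Theorems.F0P6aSheetPointTwistedMarkingInputs

end
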